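import Summits.HodgeConjecture.HodgeCM.PerL34.RestrictedTensorFunctor_1

/-! PORT of `HodgeCM/PerL34/RestrictedTensorFunctor.lean` (HodgeCMPerL run 82) — part 2: continuation of `Summits.HodgeConjecture.HodgeCM.PerL34.RestrictedTensorFunctor_1` (split at a top-level declaration boundary by port_pkg.py; scope re-opened below; declarations unchanged). -/

-- port_pkg: scope re-opened for this part (file-level context, then the namespace/section stack open at the cut)
set_option autoImplicit false
noncomputable section
open Function Set Filter
open scoped InnerProductSpace ComplexConjugate RestrictedProduct
namespace HodgeCM.PerL34.RestrictedTensor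
universe u v
variable {ι : Type u} {H : ι → Type v} [∀ i, NormedAddCommGroup (H i)]
  [∀ i, InnerProductSpace ℂ (H i)] {𝓔 : UnitFamily H}
section functoriality
universe v' v''
variable {H' : ι → Type v'} [∀ i, NormedAddCommGroup (H' i)] [∀ i, InnerProductSpace ℂ (H' i)]
  {𝓔' : UnitFamily H'}
  {H'' : ι → Type v''} [∀ i, NormedAddCommGroup (H'' i)] [∀ i, InnerProductSpace ℂ (H'' i)]
  {𝓔'' : UnitFamily H''}
section equivariance
variable {G : ι → Type*} [∀ i, Group (G i)] {Sub : ι → Type*} [∀ i, SetLike (Sub i) (G i)]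
  {B : ∀ i, Sub i} {ρ : ∀ i, G i →* (H i ≃ₗᵢ[ℂ] H i)} {ρ' : ∀ i, G i →* (H' i ≃ₗᵢ[ℂ] H' i)}
  (hρ : Admissible 𝓔 B ρ) (hρ' : Admissible 𝓔' B ρ')
variable [∀ i, SubgroupClass (Sub i) (G i)]
/-- (Ported verbatim from the HodgeCMPerL package; no docstring in the source.) -/
theorem tmapEquiv_rep (V : ∀ i, H i ≃ₗᵢ[ℂ] H' i) (hV : ∀ᶠ i in cofinite, V i (𝓔.e i) = 𝓔'.e i)
    (hint : ∀ i (g : G i) (v : H i), V i (ρ i g v) = ρ' i g (V i v)) (g : Πʳ i, [G i, B i])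
    (z : Space 𝓔) : tmapEquiv V hV (rep hρ g z) = rep hρ' g (tmapEquiv V hV z) :=
  tmap_rep hρ hρ' (fun i => (V i).toLinearIsometry) hV hint g z

end equivariance

end functoriality

/-! ## §3 Tail-dependence only: changing the reference vectors on a finite set -/

section congrVac

variable {𝓔' : UnitFamily H}

/-- Unit families on the same local spaces that EVENTUALLY agree have canonically isomorphic
restricted tensor products (componentwise identity on pure tensors). -/
def congrVac (h : ∀ᶠ i in cofinite, 𝓔.e i = 𝓔'.e i) : Space 𝓔 ≃ₗᵢ[ℂ] Space 𝓔' :=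
  tmapEquiv (fun i => LinearIsometryEquiv.refl ℂ (H i)) h

/-- A restricted family for `𝓔` is one for an eventually-equal `𝓔'`. -/
def RVec.recast (h : ∀ᶠ i in cofinite, 𝓔.e i = 𝓔'.e i) (x : RVec 𝓔) : RVec 𝓔' :=
  ⟨x.val, (x.eventually_eq.and h).mono fun _ hi => hi.1.trans hi.2⟩

/-- (Ported verbatim from the HodgeCMPerL package; no docstring in the source.) -/
@[simp] theorem RVec.recast_apply (h : ∀ᶠ i in cofinite, 𝓔.e i = 𝓔'.e i) (x : RVec 𝓔) (i : ι) :
    x.recast h i = x i := rfl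

/-- (Ported verbatim from the HodgeCMPerL package; no docstring in the source.) -/
@[simp] theorem congrVac_tp (h : ∀ᶠ i in cofinite, 𝓔.e i = 𝓔'.e i) (x : RVec 𝓔) :
    congrVac h (tp 𝓔 x) = tp 𝓔' (x.recast h) :=
  (tmapEquiv_tp _ h x).trans (congrArg (tp 𝓔') (RVec.ext fun _ => rfl))

/-- (Ported verbatim from the HodgeCMPerL package; no docstring in the source.) -/
theorem congrVac_symm_tp (h : ∀ᶠ i in cofinite, 𝓔.e i = 𝓔'.e i) (y : RVec 𝓔') :
    (congrVac h).symm (tp 𝓔' y) = tp 𝓔 (y.recast (h.mono fun _ hi => hi.symm)) :=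
  (tmapEquiv_symm_tp _ h y).trans (congrArg (tp 𝓔) (RVec.ext fun _ => rfl))

variable {G : ι → Type*} [∀ i, Group (G i)] {Sub : ι → Type*} [∀ i, SetLike (Sub i) (G i)]
  {B : ∀ i, Sub i} {ρ : ∀ i, G i →* (H i ≃ₗᵢ[ℂ] H i)}
  (hρ : Admissible 𝓔 B ρ) (hρ' : Admissible 𝓔' B ρ) [∀ i, SubgroupClass (Sub i) (G i)]

/-- … and the isomorphism intertwines the two restricted tensor product representations of the
SAME local representations. -/
theorem congrVac_rep (h : ∀ᶠ i in cofinite, 𝓔.e i = 𝓔'.e i) (g : Πʳ i, [G i, B i])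
    (z : Space 𝓔) : congrVac h (rep hρ g z) = rep hρ' g (congrVac h z) :=
  tmapEquiv_rep hρ hρ' _ h (fun _ _ _ => rfl) g z

end congrVac

end HodgeCM.PerL34.RestrictedTensor

-- port_pkg: scope closed for this part
end
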